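import Mathlib
import HarnessLib
import Summits.Ventures.LatticeQCDFlow.Exactness.NCMCGeneralSpaceOccupancyChainErgodic
import Summits.Ventures.LatticeQCDFlow.Exactness.NCMCGeneralSpaceWilsonHeatBathBar

/-!
# End to end: the NCMC chain of `latflow-snf` with heat-bath sweeps between switches is ergodic, its occupancy reads `σ(c − ΔF)` and `dF_occ` reads `ΔF` almost surely

HONEST FRAMING: exact (Metropolis-corrected) sampling algorithms for lattice gauge theory;
figures of merit are autocorrelation/cost numbers at stated couplings and volumes; no
continuum-physics claim.

Venture `LatticeQCDFlow` (cell pub-lqcd), topic `Exactness`; FANOUT row 13 (`eng-snf`, GEN-17).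
NEW WORK of the cell, not a published result; no definition is introduced; nothing is cited as a
fact.  ASSEMBLY of GEN-17's certificate `NCMCGeneralSpaceOccupancyChainErgodic.lean` (minorised
invariant level samplers ⇒ the expanded-ensemble chain is ergodic ⇒ occupancy and `dF_occ`
consistent) with row 9's heat-bath theorems (`HeatBathSweepErgodic.lean`: `heatBathSweep_invariant`,
`heatBathSweep_minorised`, `isMarkovKernel_heatBathSweep`; packaged for the torus Wilson weight in
`NCMCGeneralSpaceWilsonHeatBathBar.wilson_heatBathSweep_package`).

## Content

* §1 `heatBathSweep_package` — for a measurable joint density `0 < m ≤ p ≤ M < ∞` on a finite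
  product of probability spaces and a heat-bath scan over a list visiting every site: Markov, leaves
  `p · ⊗μ` invariant, dominates one non-zero finite measure from every configuration; the weight is
  finite and non-zero.  **`CrooksPair.ncmc_heatBath`** — THE DEFECT / BOUNDARY-CONDITION SHAPE OF THE
  ENGINE: prior weight `p₀ · ⊗μ` and target weight `p₁ · ⊗μ` two bounded densities against the SAME
  product reference (e.g. `e^{−S_OBC}` and `e^{−S_PBC}` against product Haar), heat-bath scans for
  `p₀` / `p₁` as the level samplers (`n_sweeps_prior` / `n_sweeps_target`), ANY Crooks pair between
  the two weights (stochastic protocol, SNF layers — whatever is certified), ANY `c`: the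
  expanded-ensemble chain is ergodic, the occupancy fraction converges to `σ(c − ΔF)` and
  `dF_occ,n → ΔF` almost surely.
* §2 **`CrooksPair.ncmc_wilsonHeatBath`** — THE COUPLING SHAPE: torus Wilson theory, compact second
  countable `G`, continuous `ρ`, prior `wilsonWeight ρ β₀`, target `wilsonWeight ρ β₁`, heat-bath
  link sweeps at `β₀` / `β₁` over edge lists visiting every edge: the same three conclusions.

NOT CLAIMED: rates or error bars; over-relaxation interleaving and the SU(N) Cabibbo–Marinari sweep
(the certificate needs only invariance + a measure-form minorisation, which
`NCMCGeneralSpaceSweepRestart.measure_le_comp` and `CabibboMarinariLatticeErgodic.latSweep_minorised`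
supply — not assembled here); anything numerical.
-/

namespace Summit.Ventures.LatticeQCDFlow.Exactness.GeneralNCMC

open MeasureTheory ProbabilityTheory Set Filter Finset
open scoped ENNReal Topology

/-! ## §1 Two bounded densities against one product reference, heat-bath scans as level samplers -/

section HeatBath

variable {ι : Type*} [Fintype ι] [DecidableEq ι] {X : ι → Type*} [∀ i, MeasurableSpace (X i)]
variable {μ : Π i, Measure (X i)} [∀ i, IsProbabilityMeasure (μ i)]

/-- **The heat-bath package of a bounded density.**  For a measurable joint density
`0 < m ≤ p ≤ M < ∞` on a finite product of probability spaces and a scan of single-site heat baths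
over a list visiting every site: the scan is Markov, leaves `p · ⊗μ` invariant and dominates one
non-zero finite measure from every configuration; the weight `p · ⊗μ` is finite and non-zero. -/
theorem heatBathSweep_package {p : (Π j, X j) → ℝ≥0∞} {m M : ℝ≥0∞} (hp : Measurable p)
    (hm0 : m ≠ 0) (hMtop : M ≠ ∞) (hmp : ∀ ω, m ≤ p ω) (hpM : ∀ ω, p ω ≤ M) {l : List ι}
    (hl : ∀ i, i ∈ l) :
    ∃ (_ : IsMarkovKernel (cycle (l.map (siteHeatBath μ p))))
      (_ : IsFiniteMeasure ((Measure.pi μ).withDensity p))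
      (mm : Measure (Π j, X j)) (_ : IsFiniteMeasure mm),
      (Measure.pi μ).withDensity p univ ≠ 0 ∧ mm univ ≠ 0 ∧
      Kernel.Invariant (cycle (l.map (siteHeatBath μ p))) ((Measure.pi μ).withDensity p) ∧
      ∀ z, mm ≤ cycle (l.map (siteHeatBath μ p)) z := by
  have hMk := isMarkovKernel_heatBathSweep (μ := μ) hp hm0 hMtop hmp hpM l
  have hfin : IsFiniteMeasure ((Measure.pi μ).withDensity p) :=
    isFiniteMeasure_pi_withDensity (μ := μ) hMtop hpM
  have h0 : (Measure.pi μ).withDensity p univ ≠ 0 := pi_withDensity_univ_ne_zero hm0 hmp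
  have hp_top : ∀ ω, p ω ≠ ∞ := fun ω => ne_top_of_le_ne_top hMtop (hpM ω)
  have hZ : ∀ i ω, siteNorm μ p i ω ≠ 0 := fun i ω =>
    (lt_of_lt_of_le (pos_iff_ne_zero.2 hm0) (le_siteNorm hmp i ω)).ne'
  have hZtop : ∀ i ω, siteNorm μ p i ω ≠ ∞ := fun i ω =>
    ne_top_of_le_ne_top hMtop (siteNorm_le hpM i ω)
  have hK : Kernel.Invariant (cycle (l.map (siteHeatBath μ p))) ((Measure.pi μ).withDensity p) :=
    heatBathSweep_invariant hp hp_top hZ hZtop l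
  -- a point of the (non-empty) product space bounds `m` by `M`
  obtain ⟨ω, -⟩ := nonempty_of_measure_ne_zero
    (show (Measure.pi μ) (univ : Set (Π j, X j)) ≠ 0 by rw [measure_univ]; exact one_ne_zero)
  have hmtop : m ≠ ∞ := ne_top_of_le_ne_top hMtop ((hmp ω).trans (hpM ω))
  set c : ℝ≥0∞ := (m * M⁻¹) ^ l.length with hc
  have hc_top : c ≠ ∞ :=
    ENNReal.pow_ne_top (ENNReal.mul_ne_top hmtop (ENNReal.inv_ne_top.2 (fun hM0 => hm0
      (le_antisymm ((hmp ω).trans ((hpM ω).trans hM0.le)) bot_le))))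
  have hc0 : c ≠ 0 := pow_ne_zero _ (mul_ne_zero hm0 (ENNReal.inv_ne_zero.2 hMtop))
  have hmfin : IsFiniteMeasure (c • Measure.pi μ) := Measure.smul_finite _ hc_top
  have hmu : (c • Measure.pi μ) univ ≠ 0 := by
    rw [Measure.smul_apply, smul_eq_mul, measure_univ, mul_one]
    exact hc0
  exact ⟨hMk, hfin, _, hmfin, h0, hmu, hK, heatBathSweep_minorised hp hm0 hMtop hmp hpM hl⟩

/-- **THE ENGINE'S NCMC CHAIN BETWEEN TWO BOUNDED DENSITIES, END TO END.**  Prior weight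
`p₀ · ⊗μ`, target weight `p₁ · ⊗μ` (`0 < m_k ≤ p_k ≤ M_k < ∞`, e.g. the open-defect and the
periodic action against product Haar), level samplers = heat-bath scans for `p₀` and for `p₁` over
lists visiting every site, ANY Crooks pair between the two weights and ANY constant `c`: the
expanded-ensemble chain of `run_ncmc_chain` started in `π_c` is ergodic, and along it the occupancy
fraction converges to `σ(c − ΔF)` and `dF_occ,n = c − log(p̂_n/(1 − p̂_n))` converges to `ΔF`
almost surely. -/
theorem CrooksPair.ncmc_heatBath {p₀ p₁ : (Π j, X j) → ℝ≥0∞} {m₀ M₀ m₁ M₁ : ℝ≥0∞}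
    (hp₀ : Measurable p₀) (hm₀0 : m₀ ≠ 0) (hM₀ : M₀ ≠ ∞) (hmp₀ : ∀ ω, m₀ ≤ p₀ ω)
    (hpM₀ : ∀ ω, p₀ ω ≤ M₀) {l₀ : List ι} (hl₀ : ∀ i, i ∈ l₀)
    (hp₁ : Measurable p₁) (hm₁0 : m₁ ≠ 0) (hM₁ : M₁ ≠ ∞) (hmp₁ : ∀ ω, m₁ ≤ p₁ ω)
    (hpM₁ : ∀ ω, p₁ ω ≤ M₁) {l₁ : List ι} (hl₁ : ∀ i, i ∈ l₁)
    {E : Type*} [MeasurableSpace E] {κF κR : Kernel (Π j, X j) E} [IsMarkovKernel κF]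
    [IsMarkovKernel κR] {s e : E → Π j, X j} {W : E → ℝ}
    (h : CrooksPair ((Measure.pi μ).withDensity p₀) ((Measure.pi μ).withDensity p₁) κF κR s e W)
    (c : ℝ) {ΔF : ℝ}
    (hΔF : Real.exp (-ΔF) = ((((Measure.pi μ).withDensity p₀) univ)⁻¹ *
      ((Measure.pi μ).withDensity p₁) univ).toReal) :
    ∃ (_ : IsMarkovKernel (switchKernel κF κR c W s e))
      (_ : IsMarkovKernel (levelKernel (cycle (l₀.map (siteHeatBath μ p₀)))
        (cycle (l₁.map (siteHeatBath μ p₁)))))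
      (_ : IsProbabilityMeasure ((jointWeight c ((Measure.pi μ).withDensity p₀)
        ((Measure.pi μ).withDensity p₁) univ)⁻¹ •
        jointWeight c ((Measure.pi μ).withDensity p₀) ((Measure.pi μ).withDensity p₁))),
      Ergodic (fun (z : ℕ → Bool × (Π j, X j)) (k : ℕ) => z (k + 1))
        (Kernel.trajMeasure (X := fun _ : ℕ => Bool × (Π j, X j))
          ((jointWeight c ((Measure.pi μ).withDensity p₀) ((Measure.pi μ).withDensity p₁) univ)⁻¹ •
            jointWeight c ((Measure.pi μ).withDensity p₀) ((Measure.pi μ).withDensity p₁))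
          (fun n : ℕ => (switchKernel κF κR c W s e ∘ₖ
            levelKernel (cycle (l₀.map (siteHeatBath μ p₀))) (cycle (l₁.map (siteHeatBath μ p₁)))).comap
            (fun hh : (j : ↥(Finset.Iic n)) → Bool × (Π j, X j) => hh ⟨n, Finset.mem_Iic.2 le_rfl⟩)
            (measurable_pi_apply _))) ∧
      ∀ᵐ z ∂(Kernel.trajMeasure (X := fun _ : ℕ => Bool × (Π j, X j))
          ((jointWeight c ((Measure.pi μ).withDensity p₀) ((Measure.pi μ).withDensity p₁) univ)⁻¹ •
            jointWeight c ((Measure.pi μ).withDensity p₀) ((Measure.pi μ).withDensity p₁))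
          (fun n : ℕ => (switchKernel κF κR c W s e ∘ₖ
            levelKernel (cycle (l₀.map (siteHeatBath μ p₀))) (cycle (l₁.map (siteHeatBath μ p₁)))).comap
            (fun hh : (j : ↥(Finset.Iic n)) → Bool × (Π j, X j) => hh ⟨n, Finset.mem_Iic.2 le_rfl⟩)
            (measurable_pi_apply _))),
        Tendsto (fun n : ℕ =>
            (∑ i ∈ range n, (targetLevel (Π j, X j)).indicator (1 : Bool × (Π j, X j) → ℝ) (z i)) / n)
          atTop (𝓝 (Real.sigmoid (c - ΔF))) ∧
        Tendsto (fun n : ℕ => c - Real.log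
            ((∑ i ∈ range n, (targetLevel (Π j, X j)).indicator (1 : Bool × (Π j, X j) → ℝ) (z i)) / n /
              (1 - (∑ i ∈ range n,
                (targetLevel (Π j, X j)).indicator (1 : Bool × (Π j, X j) → ℝ) (z i)) / n)))
          atTop (𝓝 ΔF) := by
  obtain ⟨hMk₀, hfin₀, mm₀, hmfin₀, h0, hm₀, hK₀, hmin₀⟩ := heatBathSweep_package (μ := μ) hp₀ hm₀0
    hM₀ hmp₀ hpM₀ hl₀
  obtain ⟨hMk₁, hfin₁, mm₁, hmfin₁, h1, hm₁, hK₁, hmin₁⟩ := heatBathSweep_package (μ := μ) hp₁ hm₁0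
    hM₁ hmp₁ hpM₁ hl₁
  haveI := hMk₀
  haveI := hMk₁
  haveI := hfin₀
  haveI := hfin₁
  haveI := hmfin₀
  haveI := hmfin₁
  refine ⟨isMarkovKernel_switchKernel (κF := κF) (κR := κR) (c := c)
      h.measurable_W h.measurable_s h.measurable_e,
    isMarkovKernel_levelKernel _ _, isProbabilityMeasure_jointLaw c _ _ h0,
    h.ergodic_ncmcChain h0 h1 hK₀ hK₁ hm₀ hm₁ hmin₀ hmin₁ c, ?_⟩
  exact (h.tendsto_occupancy_ae_ncmcChain h0 h1 hK₀ hK₁ hm₀ hm₁ hmin₀ hmin₁ c hΔF).and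
    (h.tendsto_dFocc_ae_ncmcChain h0 h1 hK₀ hK₁ hm₀ hm₁ hmin₀ hmin₁ c hΔF)

end HeatBath

/-! ## §2 Two torus Wilson couplings, heat-bath link sweeps as level samplers -/

section Wilson

open Literature.MathematicalPhysics.QuantumFieldTheory

variable {d L N : ℕ} {G : Type*} [Group G] [TopologicalSpace G] [IsTopologicalGroup G]
  (ρ : G →* Matrix (Fin N) (Fin N) ℂ) [CompactSpace G] [MeasurableSpace G] [BorelSpace G]
  [SecondCountableTopology G]

/-- **THE ENGINE'S NCMC CHAIN BETWEEN TWO WILSON COUPLINGS, END TO END.**  Torus Wilson theory,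
compact second-countable `G`, continuous `ρ`, any `d`, `L ≠ 0`; prior weight `wilsonWeight ρ β₀`,
target weight `wilsonWeight ρ β₁`, level samplers = the single-link heat-bath scans at `β₀` and at
`β₁` over edge lists visiting every edge; for EVERY Crooks pair between the two weights, EVERY
constant `c` and `e^{−ΔF} = Z_{β₁}/Z_{β₀}`: the expanded-ensemble chain started in `π_c` is
ergodic, and along it the occupancy fraction converges to `σ(c − ΔF)` and `dF_occ,n` to `ΔF`
almost surely. -/
theorem CrooksPair.ncmc_wilsonHeatBath [NeZero L] (hρ : Continuous ρ) (β₀ β₁ : ℝ)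
    {l₀ l₁ : List (Edge d L)} (hl₀ : ∀ ed, ed ∈ l₀) (hl₁ : ∀ ed, ed ∈ l₁)
    {E : Type*} [MeasurableSpace E] {κF κR : Kernel (GaugeConfig d L G) E} [IsMarkovKernel κF]
    [IsMarkovKernel κR] {s e : E → GaugeConfig d L G} {W : E → ℝ}
    (h : CrooksPair (wilsonWeight (d := d) (L := L) ρ β₀) (wilsonWeight (d := d) (L := L) ρ β₁)
      κF κR s e W) (c : ℝ) {ΔF : ℝ}
    (hΔF : Real.exp (-ΔF) = (((wilsonWeight (d := d) (L := L) ρ β₀) univ)⁻¹ *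
      (wilsonWeight (d := d) (L := L) ρ β₁) univ).toReal) :
    ∃ (_ : IsMarkovKernel (switchKernel κF κR c W s e))
      (_ : IsMarkovKernel (levelKernel
        (cycle (l₀.map (siteHeatBath (fun _ : Edge d L => haarProbability G)
          (gibbsDensity fun U : GaugeConfig d L G => β₀ * wilsonAction ρ U))))
        (cycle (l₁.map (siteHeatBath (fun _ : Edge d L => haarProbability G)
          (gibbsDensity fun U : GaugeConfig d L G => β₁ * wilsonAction ρ U))))))
      (_ : IsProbabilityMeasure ((jointWeight c (wilsonWeight (d := d) (L := L) ρ β₀)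
        (wilsonWeight (d := d) (L := L) ρ β₁) univ)⁻¹ •
        jointWeight c (wilsonWeight (d := d) (L := L) ρ β₀) (wilsonWeight (d := d) (L := L) ρ β₁))),
      Ergodic (fun (z : ℕ → Bool × GaugeConfig d L G) (k : ℕ) => z (k + 1))
        (Kernel.trajMeasure (X := fun _ : ℕ => Bool × GaugeConfig d L G)
          ((jointWeight c (wilsonWeight (d := d) (L := L) ρ β₀)
            (wilsonWeight (d := d) (L := L) ρ β₁) univ)⁻¹ •
            jointWeight c (wilsonWeight (d := d) (L := L) ρ β₀) (wilsonWeight (d := d) (L := L) ρ β₁))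
          (fun n : ℕ => (switchKernel κF κR c W s e ∘ₖ levelKernel
            (cycle (l₀.map (siteHeatBath (fun _ : Edge d L => haarProbability G)
              (gibbsDensity fun U : GaugeConfig d L G => β₀ * wilsonAction ρ U))))
            (cycle (l₁.map (siteHeatBath (fun _ : Edge d L => haarProbability G)
              (gibbsDensity fun U : GaugeConfig d L G => β₁ * wilsonAction ρ U))))).comap
            (fun hh : (j : ↥(Finset.Iic n)) → Bool × GaugeConfig d L G =>
              hh ⟨n, Finset.mem_Iic.2 le_rfl⟩) (measurable_pi_apply _))) ∧
      ∀ᵐ z ∂(Kernel.trajMeasure (X := fun _ : ℕ => Bool × GaugeConfig d L G)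
          ((jointWeight c (wilsonWeight (d := d) (L := L) ρ β₀)
            (wilsonWeight (d := d) (L := L) ρ β₁) univ)⁻¹ •
            jointWeight c (wilsonWeight (d := d) (L := L) ρ β₀) (wilsonWeight (d := d) (L := L) ρ β₁))
          (fun n : ℕ => (switchKernel κF κR c W s e ∘ₖ levelKernel
            (cycle (l₀.map (siteHeatBath (fun _ : Edge d L => haarProbability G)
              (gibbsDensity fun U : GaugeConfig d L G => β₀ * wilsonAction ρ U))))
            (cycle (l₁.map (siteHeatBath (fun _ : Edge d L => haarProbability G)
              (gibbsDensity fun U : GaugeConfig d L G => β₁ * wilsonAction ρ U))))).comap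
            (fun hh : (j : ↥(Finset.Iic n)) → Bool × GaugeConfig d L G =>
              hh ⟨n, Finset.mem_Iic.2 le_rfl⟩) (measurable_pi_apply _))),
        Tendsto (fun n : ℕ => (∑ i ∈ range n,
            (targetLevel (GaugeConfig d L G)).indicator (1 : Bool × GaugeConfig d L G → ℝ) (z i)) / n)
          atTop (𝓝 (Real.sigmoid (c - ΔF))) ∧
        Tendsto (fun n : ℕ => c - Real.log
            ((∑ i ∈ range n, (targetLevel (GaugeConfig d L G)).indicator
                (1 : Bool × GaugeConfig d L G → ℝ) (z i)) / n /
              (1 - (∑ i ∈ range n, (targetLevel (GaugeConfig d L G)).indicator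
                (1 : Bool × GaugeConfig d L G → ℝ) (z i)) / n)))
          atTop (𝓝 ΔF) := by
  obtain ⟨hMk₀, hfin₀, m₀, hmfin₀, h0, hm₀, hK₀, hmin₀⟩ := wilson_heatBathSweep_package ρ hρ β₀ hl₀
  obtain ⟨hMk₁, hfin₁, m₁, hmfin₁, h1, hm₁, hK₁, hmin₁⟩ := wilson_heatBathSweep_package ρ hρ β₁ hl₁
  haveI := hMk₀
  haveI := hMk₁
  haveI := hfin₀
  haveI := hfin₁
  haveI := hmfin₀
  haveI := hmfin₁
  refine ⟨isMarkovKernel_switchKernel (κF := κF) (κR := κR) (c := c)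
      h.measurable_W h.measurable_s h.measurable_e,
    isMarkovKernel_levelKernel _ _, isProbabilityMeasure_jointLaw c _ _ h0,
    h.ergodic_ncmcChain h0 h1 hK₀ hK₁ hm₀ hm₁ hmin₀ hmin₁ c, ?_⟩
  exact (h.tendsto_occupancy_ae_ncmcChain h0 h1 hK₀ hK₁ hm₀ hm₁ hmin₀ hmin₁ c hΔF).and
    (h.tendsto_dFocc_ae_ncmcChain h0 h1 hK₀ hK₁ hm₀ hm₁ hmin₀ hmin₁ c hΔF)

end Wilson

end Summit.Ventures.LatticeQCDFlow.Exactness.GeneralNCMC
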